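import Summits.QuantumFields.YangMills.Theorems.UnitScaleTiltProp7GaugeFixedFloorDefectDoor
import Summits.QuantumFields.YangMills.Theorems.UnitScaleTiltProp7BondAvgIterOsc
import Summits.QuantumFields.YangMills.Theorems.UnitScaleTiltProp7LaplaceAFlatLetters
import Summits.QuantumFields.YangMills.Theorems.UnitScaleTiltProp7LineAvgTridiagonal
import Summits.QuantumFields.YangMills.Theorems.UnitScaleTiltProp7LineAvgRightInverse
import HarnessLib

/-!
# Route `UnitScaleTilt`, crux «MinimiserStabilityRegPr» (stmt-QuantumFields-19200, stub EX), node N06(d = 3), route (α) — **THE LONGITUDINAL-DEFECT ROW (LD) IS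
# NECESSARY: AT THE FLAT MEMBER THE FIVE-ROW DOOR ✓`Prop7GaugeFixedFloorDefectDoor.gaugeFixedFloor_one_of_T_G_LD` CLOSES BY KERNEL WITH ZERO DISPLAYED INPUTS,
# FROM THE FLAT γ-ROW ITSELF** (and, at every background, the slice potentials exhaust the coarse gauge directions)

Cell `ym3-torus` (HUMAN RULING D-0037, YM ladder rung R3 — YM₃ on T³ is a RUNG, NOT d = 4, NOT the Clay problem; the YM mass gap is NOT proved).  Width seat
`ym-ust-19200-w5` (gen 13), positivity-block lane of the EX face (chair ★`ym-ust-19200-p1` g23: CARD-19200-V3-g23 §2 «flat member: ONE displayed input (LD)(1) — the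
template of the curved row»).  THEOREMS ONLY (0 `def`, 0 `sorry`); `--supports stmt-QuantumFields-19200 --as helper`; count-neutral.

THE PRINT.  [Balaban1985BackgroundPropagators] (3.118)–(3.122) pp. 419–420 (`A = A′ + Dλ`, the slice `R D* A = 0`, `⟨A, Δ_πA⟩ = ⟨A′, ΔA′⟩ + …`), (3.20)–(3.23) p. 394 (`R` = the
orthogonal projection onto `Δ N(Q′)`), (3.114)–(3.115) p. 418 (`Q_kDλ = D_kQ′_kλ`); [Balaban1984PropagatorsI] Prop. 1.1 (1.90) p. 33, (1.18) p. 20, (1.4) p. 18.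

WHY THIS FILE.  ✓`Prop7GaugeFixedFloorDefectDoor` (★p1 g23) splits the mixing row (X) of the γ-row's Schur door into (XM) ∧ (LD) ∧ (GQ); at the flat member four of
the five rows are kernel, leaving ONE displayed input (LD)(1) `∀ Y, D*₁Y = 0 → ∃ ℓ, (∀ μ′, ⟪Q_k(1)Y − ℓ, Q_k(1)D₁μ′⟫ = 0) ∧ ‖ℓ‖² ≤ κ·(re⟪Y, Δ^η(1)Y⟫ + a‖Q_k(1)Y‖²)`, window
`aκ < t < 1`.  Here: (LD) is NECESSARY for the γ-row at any background whose Hessian kills pure gauges (flat: ✓`DeltaEta_one_DL2_one`) — every slice floor `(γ, a)` plus a bound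
`‖Q_kA‖² ≤ M²‖A‖²` yields (LD) with `κ = (1 − γ∕(aM²))∕a`, `aκ < 1` STRICTLY (the companion of ✓`Prop7GaugeFixedFloorSchurDoor` §5's necessity of (T), (G)); with the landed flat
γ-row ✓`gaugeFixedFloor_one_piSlot` and the Jensen bound `‖Q_k(1)A‖² ≤ 4(cB∕c₀)η³‖A‖²` the flat five-row door is INHABITED with all five rows kernel.  §1 holds at EVERY
background: each coarse gauge direction `Q_k(U₀)D_{U₀}μ′` is `Q_k(U₀)D_{U₀}μ` for a SLICE `μ` (`R_S` projects onto `Δ^η N_S`, `N_S = ker(Q_k∘D)`) — the kernel form of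
LOCATE-XM-CURVED-p1g23 §2 «the slice potentials are the coarse degrees of freedom».

WHAT IS PROVED (ns `…Theorems.Prop7LongDefectOfGaugeFixedFloor`; member `F n K`, `h : n ≤ K`, weights `c₀ cB > 0`).
* §1 ★ `exists_slicePotential_Qk_DL2_eq` — EVERY `U₀`: `∀ μ′, ∃ μ, R_S(U₀)(Δ^η_{U₀}μ) = 0 ∧ Q_k(U₀)D_{U₀}μ = Q_k(U₀)D_{U₀}μ′`.
* §2 ★ `norm_sq_Qk_one_le` — the Jensen row at the flat member: `‖Q_k(1)A‖² ≤ 4·(cB∕c₀)·((L^(K−n))³)⁻¹·‖A‖²` (so `a‖Q_k(1)A‖² ≤ 4a₀‖A‖²` at print's `a = a₀(c₀∕cB)η⁻³`).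
* §3 ★★★ `longDefect_of_gaugeFixedFloor_of_hessian_kills_gauges` — EVERY `U₀` with `Δ^η(U₀)(D_{U₀}μ) = 0 ∀μ` (symbolic background; (XM) ≡ 0 in the strongest form):
  the (LD) row VERBATIM from ANY slice floor `(γ, a)` and ANY `M²` with `γ ≤ aM²`, constant `κ := (1 − γ∕(aM²))∕a` (at `U₀ = 1`: `hflat :=` ✓`DeltaEta_one_DL2_one`).
* §4 ★★ `longDefect_one` — (LD)(1) at print's coupling `a = a₀(c₀∕cB)η⁻³` with `κ := (1 − 1∕(16·a₀·Cst 3 a₀))∕a` (member-uniform `aκ = 1 − 1∕(16·a₀·Cst 3 a₀) < 1`).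
* §5 ★★ `gaugeFixedFloor_one_of_fiveRows` — the flat five-row door with ALL FIVE ROWS KERNEL: (T)(1) ✓`transverseFloor_one`, (G)(1) ✓`sliceGaugeFloor_one`, (LD)(1) §4, at
  `t := 1 − δ∕2`, `δ := 1∕(16·a₀·Cst 3 a₀)`: floor `min((1 − (1−δ)∕(1−δ∕2))·γ₀, (δ∕2)·γ₀)`, `γ₀ = 1∕(4·Cst 3 a₀)` — member-uniform, positive.
HONEST SCOPE.  Finite-dimensional linear algebra over landed letters; §§2,4,5 at the flat member only, CIRCULAR IN CONTENT there (§5 re-derives a WEAKER flat γ-row from the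
flat γ-row) — a DOOR-DESIGN CHECK (the split loses only constants; the window `aκ < t < 1` is open, member-uniformly) plus §1∕§3 as background-generic doors.  It does NOT
compute print's (1.90) mode-by-mode `κ` and proves NOTHING at curved members: (LD), (T), (G), `hGF` curved, the other print rows, `hThm2S`, EX, the crux NOT proved; rung R3, not Clay.

References: T. Bałaban, CMP **99** (1985) 389–434 [Balaban1985BackgroundPropagators]; CMP **95** (1984) 17–40 [Balaban1984PropagatorsI] (Prop. 1.1 (1.90) p.33, (1.18), (1.4)).
-/

set_option autoImplicit false

noncomputable section

open scoped InnerProductSpace ComplexConjugate Matrix.Norms.L2Operator BigOperators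

namespace Summit.QuantumFields.YangMills.Theorems.Prop7LongDefectOfGaugeFixedFloor

open Literature.MathematicalPhysics.QuantumFieldTheory.Balaban1983to89
open Literature.MathematicalPhysics.QuantumFieldTheory.Balaban1983to89.T3ContinuumYM3Torus
open T3SectALandauChart (eta eta_pos)
open B9Eq311L2Pairing (WL2)
open B11Eq103H1Complex (SiteL2K BondL2K projR exists_ker_projR_eq projR_projR)
open LatticeFieldCalculus (bondAvgIter runSite)
open Summit.QuantumFields.YangMills.Theorems.Prop7SectET3Transport (periodsT3)
open Summit.QuantumFields.YangMills.Theorems.Prop7SectET3HilbertLetters (W₂ toL2 toL2B QL2 DL2 DstarL2 covLapSite)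
open Summit.QuantumFields.YangMills.Theorems.Prop7SectET3GaugeProjector (RS QDS QDS_apply RS_eq_projR)
open Summit.QuantumFields.YangMills.Theorems.Prop7SectET3WilsonHessian (DeltaEta)
open Summit.QuantumFields.YangMills.Theorems.Prop7SectET3CurvedPropagators (Qk)
open Summit.QuantumFields.YangMills.Theorems.Prop7SectET3OpsT3HilbertRows (inner_DL2_left)
open Summit.QuantumFields.YangMills.Theorems.Prop7GaugeFixedFloorDefectDoor (gaugeFixedFloor_one_of_T_G_LD transverseFloor_one sliceGaugeFloor_one)
open Summit.QuantumFields.YangMills.Theorems.Prop7CoerciveOfGaugeFixedLift (gaugeFixedFloor_one_piSlot)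
open Summit.QuantumFields.YangMills.Theorems.Prop7LaplaceAFlatLetters (norm_sq_Qk_one norm_sq_toL2)
open Summit.QuantumFields.YangMills.Theorems.Prop7BondAvgIterOsc (norm_sq_bondAvgIter_sub_const_le)
open Summit.QuantumFields.YangMills.Theorems.Prop7LineAvgRightInverse (sum_pbond_fine_eq sum_dir_site_eq sum_pbond_runSite_one)
open Summit.QuantumFields.YangMills.Theorems.Prop7FlatCoercivity (sitesPerDir_T3)

variable {F : T3Family} {n K : ℕ} {h : n ≤ K} {c₀ cB : ℝ} [Fact (0 < c₀)] [Fact (0 < cB)]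

/-! ## §1 Every background: the slice potentials exhaust the coarse gauge directions -/

omit [Fact (0 < cB)] in
/-- ★† **THE SLICE POTENTIALS EXHAUST THE COARSE GAUGE DIRECTIONS** (every background `U₀`; † background-generic, reusable by every curved supplier of (G)∕(LD) —
chair ★p1 g23 GO 2026-08-29): for every gauge parameter `μ′` there is a SLICE potential `μ`
(`R_S(U₀) Δ^η_{U₀} μ = 0`, the slice condition of ✓`Prop7GaugeFixedFloorSchurDoor.RS_covLapSite_eq_zero_of_slice`) with the same coarse gauge direction
`Q_k(U₀)D_{U₀}μ = Q_k(U₀)D_{U₀}μ′` — since `R_S` is the orthogonal projection onto `Δ^η N_S`, `N_S = ker(Q_k∘D_{U₀})` ((3.21)–(3.22)): `R_S(Δμ′) = Δν₀` with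
`ν₀ ∈ N_S`, and `μ := μ′ − ν₀`. [cite: Balaban1985BackgroundPropagators, (3.20)-(3.23) p.394, (3.114)-(3.115) p.418] -/
theorem exists_slicePotential_Qk_DL2_eq (U₀ : GaugeField (F.P K) 0 (Matrix.specialUnitaryGroup (Fin 2) ℂ)) (μ' : SiteL2K ℂ 3 (periodsT3 F K) c₀ W₂) :
    ∃ μ : SiteL2K ℂ 3 (periodsT3 F K) c₀ W₂, RS F n K h c₀ cB U₀ (covLapSite F n K c₀ U₀ μ) = 0 ∧
      Qk F n K h c₀ cB U₀ (DL2 F n K c₀ U₀ μ) = Qk F n K h c₀ cB U₀ (DL2 F n K c₀ U₀ μ') := by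
  obtain ⟨ν, hν, hR⟩ := exists_ker_projR_eq (covLapSite F n K c₀ U₀) (QDS F n K h c₀ cB U₀) (covLapSite F n K c₀ U₀ μ')
  refine ⟨μ' - ν, ?_, ?_⟩
  · rw [RS_eq_projR, map_sub, map_sub, ← hR, projR_projR, sub_self]
  · have hν' : QL2 F n K h c₀ cB U₀ (DL2 F n K c₀ U₀ ν) = 0 := by rw [← QDS_apply]; exact hν
    have h0 : Qk F n K h c₀ cB U₀ (DL2 F n K c₀ U₀ ν) = 0 := by
      show (((eta F n K : ℝ) : ℂ)) • QL2 F n K h c₀ cB U₀ (DL2 F n K c₀ U₀ ν) = 0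
      rw [hν', smul_zero]
    rw [map_sub, map_sub, h0, sub_zero]

/-! ## §2 The Jensen row at the flat member: `‖Q_k(1)A‖² ≤ 4(cB∕c₀)η³‖A‖²` -/

/-- ★ **THE JENSEN ROW FOR THE AVERAGING OF RECORD AT THE FLAT MEMBER**: `‖Q_k(1)A‖² ≤ 4·(cB∕c₀)·((L^(K−n))³)⁻¹·‖A‖²` — the two-block tent average `Q_{K−n}` of a fine bond
field is bounded in `ℓ²` by `2·L^{−(K−n)d}·`(the field on the two blocks) (✓`Prop7BondAvgIterOsc.norm_sq_bondAvgIter_sub_const_le` at `C = 0`), and each fine bond is counted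
twice; entrywise on `M₂(ℂ)` through ✓`Prop7LaplaceAFlatLetters.norm_sq_Qk_one` ∕ `norm_sq_toL2`.  So at print's coupling `a = a₀(c₀∕cB)η⁻³` the averaging penalty is bounded:
`a‖Q_k(1)A‖² ≤ 4a₀‖A‖²`. [cite: Balaban1984PropagatorsI, (1.18) p.20; Balaban1985BackgroundPropagators, (3.24) p.394] -/
theorem norm_sq_Qk_one_le (A : BondL2K ℂ 3 (periodsT3 F K) c₀ W₂) :
    ‖Qk F n K h c₀ cB (1 : GaugeField (F.P K) 0 (Matrix.specialUnitaryGroup (Fin 2) ℂ)) A‖ ^ 2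
      ≤ 4 * (cB / c₀) * (((F.L : ℝ) ^ (K - n)) ^ 3)⁻¹ * ‖A‖ ^ 2 := by
  classical
  have hc₀ : 0 < c₀ := Fact.out
  have hcB : 0 < cB := Fact.out
  set X : PBond (F.P K) 0 → Matrix (Fin 2) (Fin 2) ℂ := (toL2 F K c₀).symm A with hX
  have hA : A = toL2 F K c₀ X := by rw [hX, LinearEquiv.apply_symm_apply]
  rw [hA, norm_sq_Qk_one X, norm_sq_toL2 X]
  -- the lattice letters
  have hk : K - n ≤ (F.P K).m + (F.P K).K := by show K - n ≤ F.m + K; omega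
  have hsp : (F.P K).sitesPerDir 0 = (F.P K).L ^ (K - n) * (F.P K).sitesPerDir (K - n) := sitesPerDir_T3 F n K
  have hw : ((((F.P K).L : ℝ) ^ (K - n)) ^ (F.P K).d)⁻¹ = (((F.L : ℝ) ^ (K - n)) ^ 3)⁻¹ := rfl
  -- ENTRY BY ENTRY: the complex bond field `b ↦ X b i i′`
  have hent : ∀ i i' : Fin 2,
      ∑ c : PBond (F.P K) (K - n), ‖bondAvgIter (K - n) X c i i'‖ ^ 2 ≤ 4 * (((F.L : ℝ) ^ (K - n)) ^ 3)⁻¹ * ∑ b : PBond (F.P K) 0, ‖X b i i'‖ ^ 2 := by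
    intro i i'
    -- `Q_k` commutes with taking the `(i,i′)` entry
    have e : ∀ c : PBond (F.P K) (K - n), bondAvgIter (K - n) X c i i' = bondAvgIter (K - n) (fun b => X b i i') c := fun c =>
      (ChartHInv.bondAvgIter_comp_apply (Matrix.entryLinearMap ℝ ℂ i i') (K - n) X c).symm
    -- Jensen on each coarse bond (two blocks, tent weights)
    have h1 : ∀ c : PBond (F.P K) (K - n), ‖bondAvgIter (K - n) (fun b => X b i i') c‖ ^ 2
        ≤ 2 * (((F.L : ℝ) ^ (K - n)) ^ 3)⁻¹ *
          (∑ r : Fin (F.P K).d → Fin ((F.P K).L ^ (K - n)), ‖X ⟨Site.fibreSite 0 (K - n) c.src r, c.dir⟩ i i'‖ ^ 2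
            + ∑ r : Fin (F.P K).d → Fin ((F.P K).L ^ (K - n)), ‖X ⟨Site.fibreSite 0 (K - n) (runSite c.src c.dir 1) r, c.dir⟩ i i'‖ ^ 2) := by
      intro c
      have h0 := norm_sq_bondAvgIter_sub_const_le (V := ℂ) hk hsp (fun b => X b i i') c 0
      simp only [sub_zero] at h0
      rw [hw] at h0
      exact h0
    -- the two block sums are the full fine sum (each fine bond once per block family)
    have hf1 : ∑ c : PBond (F.P K) (K - n), ∑ r : Fin (F.P K).d → Fin ((F.P K).L ^ (K - n)), ‖X ⟨Site.fibreSite 0 (K - n) c.src r, c.dir⟩ i i'‖ ^ 2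
        = ∑ b : PBond (F.P K) 0, ‖X b i i'‖ ^ 2 := by
      rw [sum_pbond_fine_eq hsp (fun b : PBond (F.P K) 0 => ‖X b i i'‖ ^ 2), ← sum_dir_site_eq]
    have hf2 : ∑ c : PBond (F.P K) (K - n), ∑ r : Fin (F.P K).d → Fin ((F.P K).L ^ (K - n)), ‖X ⟨Site.fibreSite 0 (K - n) (runSite c.src c.dir 1) r, c.dir⟩ i i'‖ ^ 2
        = ∑ b : PBond (F.P K) 0, ‖X b i i'‖ ^ 2 := by
      rw [sum_pbond_runSite_one (fun c : PBond (F.P K) (K - n) =>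
        ∑ r : Fin (F.P K).d → Fin ((F.P K).L ^ (K - n)), ‖X ⟨Site.fibreSite 0 (K - n) c.src r, c.dir⟩ i i'‖ ^ 2)]
      exact hf1
    calc ∑ c : PBond (F.P K) (K - n), ‖bondAvgIter (K - n) X c i i'‖ ^ 2
        = ∑ c : PBond (F.P K) (K - n), ‖bondAvgIter (K - n) (fun b => X b i i') c‖ ^ 2 := by simp only [e]
      _ ≤ ∑ c : PBond (F.P K) (K - n), 2 * (((F.L : ℝ) ^ (K - n)) ^ 3)⁻¹ *
          (∑ r : Fin (F.P K).d → Fin ((F.P K).L ^ (K - n)), ‖X ⟨Site.fibreSite 0 (K - n) c.src r, c.dir⟩ i i'‖ ^ 2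
            + ∑ r : Fin (F.P K).d → Fin ((F.P K).L ^ (K - n)), ‖X ⟨Site.fibreSite 0 (K - n) (runSite c.src c.dir 1) r, c.dir⟩ i i'‖ ^ 2) :=
          Finset.sum_le_sum fun c _ => h1 c
      _ = 4 * (((F.L : ℝ) ^ (K - n)) ^ 3)⁻¹ * ∑ b : PBond (F.P K) 0, ‖X b i i'‖ ^ 2 := by
          rw [← Finset.mul_sum, Finset.sum_add_distrib, hf1, hf2]; ring
  -- ASSEMBLY over the four entries
  have hS : ∑ c : PBond (F.P K) (K - n), ∑ i, ∑ i', ‖bondAvgIter (K - n) X c i i'‖ ^ 2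
      ≤ 4 * (((F.L : ℝ) ^ (K - n)) ^ 3)⁻¹ * ∑ b : PBond (F.P K) 0, ∑ i, ∑ i', ‖X b i i'‖ ^ 2 := by
    calc ∑ c : PBond (F.P K) (K - n), ∑ i, ∑ i', ‖bondAvgIter (K - n) X c i i'‖ ^ 2
        = ∑ i : Fin 2, ∑ i' : Fin 2, ∑ c : PBond (F.P K) (K - n), ‖bondAvgIter (K - n) X c i i'‖ ^ 2 := by
          calc ∑ c : PBond (F.P K) (K - n), ∑ i : Fin 2, ∑ i' : Fin 2, ‖bondAvgIter (K - n) X c i i'‖ ^ 2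
              = ∑ i : Fin 2, ∑ c : PBond (F.P K) (K - n), ∑ i' : Fin 2, ‖bondAvgIter (K - n) X c i i'‖ ^ 2 := Finset.sum_comm
            _ = ∑ i : Fin 2, ∑ i' : Fin 2, ∑ c : PBond (F.P K) (K - n), ‖bondAvgIter (K - n) X c i i'‖ ^ 2 :=
                Finset.sum_congr rfl fun i _ => Finset.sum_comm
      _ ≤ ∑ i, ∑ i', 4 * (((F.L : ℝ) ^ (K - n)) ^ 3)⁻¹ * ∑ b : PBond (F.P K) 0, ‖X b i i'‖ ^ 2 :=
          Finset.sum_le_sum fun i _ => Finset.sum_le_sum fun i' _ => hent i i'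
      _ = 4 * (((F.L : ℝ) ^ (K - n)) ^ 3)⁻¹ * ∑ i : Fin 2, ∑ i' : Fin 2, ∑ b : PBond (F.P K) 0, ‖X b i i'‖ ^ 2 := by
          rw [Finset.mul_sum]
          refine Finset.sum_congr rfl fun i _ => ?_
          rw [Finset.mul_sum]
      _ = 4 * (((F.L : ℝ) ^ (K - n)) ^ 3)⁻¹ * ∑ b : PBond (F.P K) 0, ∑ i, ∑ i', ‖X b i i'‖ ^ 2 := by
          congr 1
          calc ∑ i : Fin 2, ∑ i' : Fin 2, ∑ b : PBond (F.P K) 0, ‖X b i i'‖ ^ 2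
              = ∑ i : Fin 2, ∑ b : PBond (F.P K) 0, ∑ i' : Fin 2, ‖X b i i'‖ ^ 2 :=
                Finset.sum_congr rfl fun i _ => Finset.sum_comm
            _ = ∑ b : PBond (F.P K) 0, ∑ i : Fin 2, ∑ i' : Fin 2, ‖X b i i'‖ ^ 2 := Finset.sum_comm
  calc cB * ∑ c : PBond (F.P K) (K - n), ∑ i, ∑ i', ‖bondAvgIter (K - n) X c i i'‖ ^ 2
      ≤ cB * (4 * (((F.L : ℝ) ^ (K - n)) ^ 3)⁻¹ * ∑ b : PBond (F.P K) 0, ∑ i, ∑ i', ‖X b i i'‖ ^ 2) :=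
        mul_le_mul_of_nonneg_left hS hcB.le
    _ = 4 * (cB / c₀) * (((F.L : ℝ) ^ (K - n)) ^ 3)⁻¹ * (c₀ * ∑ b : PBond (F.P K) 0, ∑ i, ∑ i', ‖X b i i'‖ ^ 2) := by
        field_simp

/-! ## §3 (LD)(1) is necessary for the flat γ-row -/

/-- The real-variable core of §3: from `γ(Y² + s²g) ≤ E − 2asq + as²q` for all real `s`, `q ≤ M²g`, `γY² ≤ E`, `γ ≤ aM²` conclude `q ≤ ((1 − γ∕(aM²))∕a)·E`
(take `s := 1∕(1 − γ∕(aM²))`; the degenerate case `γ = aM²` forces `q = 0`). [folklore] -/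
theorem defect_le_of_quadratic {E q g γ a M2 Y2 : ℝ} (ha : 0 < a) (hM : 0 < M2) (hγ : 0 ≤ γ) (hγM : γ ≤ a * M2) (hq0 : 0 ≤ q)
    (hY : 0 ≤ Y2) (hPY : γ * Y2 ≤ E) (hqg : q ≤ M2 * g)
    (hrow : ∀ s : ℝ, γ * (Y2 + s ^ 2 * g) ≤ E - 2 * a * s * q + a * s ^ 2 * q) :
    q ≤ (1 - γ / (a * M2)) / a * E := by
  have haM : 0 < a * M2 := mul_pos ha hM
  have hE0 : 0 ≤ E := le_trans (mul_nonneg hγ hY) hPY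
  -- `θ := 1 − γ/(aM²) ∈ [0,1]` and `aθq = aq − (γ/M²)q`
  obtain ⟨θ, hθ⟩ : ∃ θ : ℝ, θ = 1 - γ / (a * M2) := ⟨_, rfl⟩
  have hθ0 : 0 ≤ θ := by rw [hθ, sub_nonneg, div_le_one haM]; exact hγM
  have h3 : a * θ * q = a * q - γ / M2 * q := by rw [hθ]; field_simp
  -- the key inequality `0 ≤ E − 2asq + s²·aθq` for every `s`
  have hkey : ∀ s : ℝ, 0 ≤ E - 2 * a * s * q + s ^ 2 * (a * θ * q) := by
    intro s
    have h1 := hrow s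
    have h2 : s ^ 2 * (γ / M2 * q) ≤ s ^ 2 * (γ * g) := by
      apply mul_le_mul_of_nonneg_left _ (sq_nonneg s)
      rw [div_mul_eq_mul_div, div_le_iff₀ hM]
      calc γ * q ≤ γ * (M2 * g) := mul_le_mul_of_nonneg_left hqg hγ
        _ = γ * g * M2 := by ring
    rw [h3]
    nlinarith [h1, h2, mul_nonneg hγ hY]
  rw [← hθ]
  by_cases hθz : θ = 0
  · -- `2asq ≤ E` for every `s`: `q = 0`
    have hqz : q = 0 := by
      by_contra hne
      have hqp : 0 < q := lt_of_le_of_ne hq0 (Ne.symm hne)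
      have h1 := hkey ((E + 1) / (2 * a * q))
      rw [hθz, mul_zero, zero_mul, mul_zero, add_zero] at h1
      have e : 2 * a * ((E + 1) / (2 * a * q)) * q = E + 1 := by
        field_simp
      linarith
    rw [hqz, hθz, zero_div, zero_mul]
  · have hθp : 0 < θ := lt_of_le_of_ne hθ0 (Ne.symm hθz)
    have h1 := hkey (1 / θ)
    have e : E - 2 * a * (1 / θ) * q + (1 / θ) ^ 2 * (a * θ * q) = E - a * q / θ := by
      field_simp
      ring
    rw [e] at h1
    have h5 : a * q / θ ≤ E := by linarith
    rw [div_le_iff₀ hθp] at h5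
    rw [div_mul_eq_mul_div, le_div_iff₀ ha]
    linarith

/-- ★★★ **(LD) FROM THE γ-ROW AT ANY BACKGROUND WHOSE HESSIAN KILLS PURE GAUGES — THE LONGITUDINAL-DEFECT ROW IS NECESSARY.**  At a background `U₀` with
`Δ^η(U₀)(D_{U₀}μ) = 0` for all `μ` (`hflat` — the flat member by ✓`Prop7LaplaceAFlatCoercive.DeltaEta_one_DL2_one`; any background where a supplier proves (XM) ≡ 0 this way):
if the gauge-fixed slice floor `γ‖A‖² ≤ re⟨A, Δ^η(U₀)A⟩ + a‖Q_k(U₀)A‖²` holds on `{R_S(U₀) D*_{U₀} A = 0}` (`0 ≤ γ`, `0 < a`) and `‖Q_k(U₀)A‖² ≤ M²·‖A‖²` with `γ ≤ a·M²`, then for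
every transverse `Y` the orthogonal projection `ℓ` of `Q_kY` onto `range(Q_k∘D_{U₀})` satisfies `‖ℓ‖² ≤ κ·(re⟨Y, Δ^η(U₀)Y⟩ + a‖Q_kY‖²)`, `κ := (1 − γ∕(aM²))∕a` — so `aκ < 1`
STRICTLY whenever `γ > 0`: the (LD) row of ✓`gaugeFixedFloor_of_T_G_XM_LD` VERBATIM (symbolic `γ a M²`, `U₀`).  PROOF: `ℓ = Q_kD_{U₀}μ` for a SLICE `μ` (§1); test the floor on
`Y − s·D_{U₀}μ` (slice; `hflat` + symmetry of `Δ^η` kill the Hessian terms): `0 ≤ (E − γ‖Y‖²) − 2as‖ℓ‖² + s²(a‖ℓ‖² − γ‖D_{U₀}μ‖²)` ∀ `s`, `‖ℓ‖² ≤ M²‖D_{U₀}μ‖²`, `s := 1∕(1 − γ∕(aM²))`.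
[cite: Balaban1985BackgroundPropagators, (3.118)-(3.122) pp.419-420, (3.10)-(3.12) p.392; Balaban1984PropagatorsI, Prop. 1.1 (1.90) p.33, (1.4) p.18] -/
theorem longDefect_of_gaugeFixedFloor_of_hessian_kills_gauges (U₀ : GaugeField (F.P K) 0 (Matrix.specialUnitaryGroup (Fin 2) ℂ))
    (hflat : ∀ μ : SiteL2K ℂ 3 (periodsT3 F K) c₀ W₂, DeltaEta F n K c₀ U₀ (DL2 F n K c₀ U₀ μ) = 0)
    {γ a M2 : ℝ} (hγ : 0 ≤ γ) (ha : 0 < a) (hM : 0 < M2) (hγM : γ ≤ a * M2)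
    (hGF : ∀ A : BondL2K ℂ 3 (periodsT3 F K) c₀ W₂,
      RS F n K h c₀ cB U₀ (DstarL2 F n K c₀ U₀ A) = 0 →
        γ * ‖A‖ ^ 2 ≤ RCLike.re ⟪A, DeltaEta F n K c₀ U₀ A⟫_ℂ + a * ‖Qk F n K h c₀ cB U₀ A‖ ^ 2)
    (hQ : ∀ A : BondL2K ℂ 3 (periodsT3 F K) c₀ W₂, ‖Qk F n K h c₀ cB U₀ A‖ ^ 2 ≤ M2 * ‖A‖ ^ 2) :
    ∀ Y : BondL2K ℂ 3 (periodsT3 F K) c₀ W₂, DstarL2 F n K c₀ U₀ Y = 0 →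
      ∃ ℓ : WL2 ℂ (fun _ : PBond (F.P n) 0 => cB) W₂,
        (∀ μ' : SiteL2K ℂ 3 (periodsT3 F K) c₀ W₂, ⟪Qk F n K h c₀ cB U₀ Y - ℓ, Qk F n K h c₀ cB U₀ (DL2 F n K c₀ U₀ μ')⟫_ℂ = 0) ∧
        ‖ℓ‖ ^ 2 ≤ ((1 - γ / (a * M2)) / a) * (RCLike.re ⟪Y, DeltaEta F n K c₀ U₀ Y⟫_ℂ + a * ‖Qk F n K h c₀ cB U₀ Y‖ ^ 2) := by
  intro Y hY
  -- the coarse gauge directions `W = range(Q_k ∘ D)` and the orthogonal split `Q_kY = ℓ + z`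
  set T : SiteL2K ℂ 3 (periodsT3 F K) c₀ W₂ →ₗ[ℂ] WL2 ℂ (fun _ : PBond (F.P n) 0 => cB) W₂ :=
    Qk F n K h c₀ cB U₀ ∘ₗ DL2 F n K c₀ U₀ with hT
  obtain ⟨ℓ, hℓ, z, hz, hsplit⟩ := Submodule.exists_add_mem_mem_orthogonal (K := LinearMap.range T) (Qk F n K h c₀ cB U₀ Y)
  have hdiff : Qk F n K h c₀ cB U₀ Y - ℓ = z := by rw [hsplit]; abel
  refine ⟨ℓ, fun μ' => ?_, ?_⟩
  · rw [hdiff]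
    exact Submodule.inner_left_of_mem_orthogonal (K := LinearMap.range T) (LinearMap.mem_range_self T μ') hz
  -- `ℓ = Q_k D μ` for a slice potential `μ`
  obtain ⟨μ', hμ'⟩ := LinearMap.mem_range.1 hℓ
  obtain ⟨μ, hμR, hμQ⟩ := exists_slicePotential_Qk_DL2_eq (h := h) (cB := cB) U₀ μ'
  have hQμ : Qk F n K h c₀ cB U₀ (DL2 F n K c₀ U₀ μ) = ℓ := by rw [hμQ, ← hμ']; rfl
  -- letters
  set E : ℝ := RCLike.re ⟪Y, DeltaEta F n K c₀ U₀ Y⟫_ℂ + a * ‖Qk F n K h c₀ cB U₀ Y‖ ^ 2 with hE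
  set q : ℝ := ‖ℓ‖ ^ 2 with hq
  set g : ℝ := ‖DL2 F n K c₀ U₀ μ‖ ^ 2 with hg
  have hq0 : 0 ≤ q := by positivity
  -- the row at `A = Y`: `γ‖Y‖² ≤ E`
  have hYs : RS F n K h c₀ cB U₀ (DstarL2 F n K c₀ U₀ Y) = 0 := by rw [hY, map_zero]
  have hPY : γ * ‖Y‖ ^ 2 ≤ E := hGF Y hYs
  -- `re⟪Q_kY, ℓ⟫ = ‖ℓ‖²` and `‖ℓ‖² ≤ M²‖Dμ‖²`
  have hQYℓ : RCLike.re ⟪Qk F n K h c₀ cB U₀ Y, ℓ⟫_ℂ = q := by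
    have hzℓ : ⟪z, ℓ⟫_ℂ = 0 := Submodule.inner_left_of_mem_orthogonal (K := LinearMap.range T) hℓ hz
    rw [hsplit, inner_add_left, hzℓ, add_zero, hq, @norm_sq_eq_re_inner ℂ]
  have hqg : q ≤ M2 * g := by
    have := hQ (DL2 F n K c₀ U₀ μ)
    rwa [hQμ] at this
  -- the symmetric Hessian kills the pure gauge `Dμ` on both sides of the pairing
  have hsym := Prop7GaugeFixedFloorSchurDoor.re_inner_symm_of_isSymmetric
    (Prop7SectET3WilsonHessian.DeltaEta_isSymmetric (F := F) (n := n) (K := K) (c₀ := c₀) U₀)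
  have e1 : RCLike.re ⟪Y, DeltaEta F n K c₀ U₀ (DL2 F n K c₀ U₀ μ)⟫_ℂ = 0 := by rw [hflat μ, inner_zero_right, map_zero]
  have e2 : RCLike.re ⟪DL2 F n K c₀ U₀ μ, DeltaEta F n K c₀ U₀ Y⟫_ℂ = 0 := by
    have hs := hsym (DL2 F n K c₀ U₀ μ) Y
    simp only [ContinuousLinearMap.coe_coe] at hs
    rw [← hs, e1]
  have e3 : RCLike.re ⟪DL2 F n K c₀ U₀ μ, DeltaEta F n K c₀ U₀ (DL2 F n K c₀ U₀ μ)⟫_ℂ = 0 := by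
    rw [hflat μ, inner_zero_right, map_zero]
  -- the row at `A_s = Y − s·Dμ`, for every real `s`
  have hrow : ∀ s : ℝ, γ * (‖Y‖ ^ 2 + s ^ 2 * g) ≤ E - 2 * a * s * q + a * s ^ 2 * q := by
    intro s
    set A : BondL2K ℂ 3 (periodsT3 F K) c₀ W₂ := Y - ((s : ℝ) : ℂ) • DL2 F n K c₀ U₀ μ with hAdef
    -- slice
    have hAs : RS F n K h c₀ cB U₀ (DstarL2 F n K c₀ U₀ A) = 0 := by
      rw [hAdef, map_sub, map_smul, hY, zero_sub, map_neg, map_smul, neg_eq_zero]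
      show ((s : ℝ) : ℂ) • RS F n K h c₀ cB U₀ (covLapSite F n K c₀ U₀ μ) = 0
      rw [hμR, smul_zero]
    have h1 := hGF A hAs
    -- `‖A‖² = ‖Y‖² + s²·g`
    have hYD : ⟪Y, DL2 F n K c₀ U₀ μ⟫_ℂ = 0 := by
      rw [← inner_conj_symm, inner_DL2_left, hY, inner_zero_right, map_zero]
    have hnA : ‖A‖ ^ 2 = ‖Y‖ ^ 2 + s ^ 2 * g := by
      rw [hAdef, @norm_sub_sq ℂ, inner_smul_right, hYD, mul_zero, map_zero, mul_zero, sub_zero, norm_smul, mul_pow, hg,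
        Complex.norm_real, Real.norm_eq_abs, sq_abs]
    -- `re⟪A, ΔA⟫ = re⟪Y, ΔY⟫`
    have hΔ : RCLike.re ⟪A, DeltaEta F n K c₀ U₀ A⟫_ℂ = RCLike.re ⟪Y, DeltaEta F n K c₀ U₀ Y⟫_ℂ := by
      rw [hAdef]
      simp only [map_sub, map_smul, inner_sub_left, inner_sub_right, inner_smul_left, inner_smul_right, map_sub,
        Complex.conj_ofReal]
      simp only [RCLike.re_to_complex, Complex.sub_re, Complex.mul_re, Complex.ofReal_re, Complex.ofReal_im, zero_mul, sub_zero] at e1 e2 e3 ⊢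
      have e1' : (⟪Y, DeltaEta F n K c₀ U₀ (DL2 F n K c₀ U₀ μ)⟫_ℂ).re = 0 := e1
      have e2' : (⟪DL2 F n K c₀ U₀ μ, DeltaEta F n K c₀ U₀ Y⟫_ℂ).re = 0 := e2
      have e3' : (⟪DL2 F n K c₀ U₀ μ, DeltaEta F n K c₀ U₀ (DL2 F n K c₀ U₀ μ)⟫_ℂ).re = 0 := e3
      rw [e1', e2', e3']
      ring
    -- `‖Q_kA‖² = ‖Q_kY‖² − 2s·q + s²·q`
    have hQA : ‖Qk F n K h c₀ cB U₀ A‖ ^ 2 = ‖Qk F n K h c₀ cB U₀ Y‖ ^ 2 - 2 * s * q + s ^ 2 * q := by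
      rw [hAdef, map_sub, map_smul, hQμ, @norm_sub_sq ℂ, inner_smul_right, norm_smul, mul_pow]
      have : RCLike.re ((((s : ℝ) : ℂ)) * ⟪Qk F n K h c₀ cB U₀ Y, ℓ⟫_ℂ) = s * q := by
        rw [← hQYℓ]; simp
      rw [this, hq, Complex.norm_real, Real.norm_eq_abs, sq_abs]
      ring
    rw [hnA, hΔ, hQA] at h1
    rw [hE]
    linarith
  -- conclude by the real-variable core
  exact defect_le_of_quadratic ha hM hγ hγM hq0 (sq_nonneg ‖Y‖) hPY hqg hrow

/-! ## §4 (LD)(1) at print's coupling -/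

/-- ★★ **(LD)(1) HOLDS, WITH A MEMBER-UNIFORM `aκ < 1`**: at the flat member and print's coupling `a = a₀·(c₀∕cB)·η⁻³` (`a₀ > 0`), every transverse `Y` has an `ℓ` with
`Q_k(1)Y − ℓ ⊥ range(Q_k(1)∘D₁)` and `‖ℓ‖² ≤ κ·(re⟨Y, Δ^η(1)Y⟩ + a‖Q_k(1)Y‖²)`, `κ := (1 − 1∕(16·a₀·Cst 3 a₀))∕a` — the displayed flat input of
✓`gaugeFixedFloor_one_of_T_G_LD`, from the landed flat γ-row ✓`gaugeFixedFloor_one_piSlot` (`γ₀ = 1∕(4·Cst 3 a₀)`, [B4] (1.90)) by §3 at `U₀ = 1` (`hflat :=` ✓`DeltaEta_one_DL2_one`) and the Jensen row §2 (`aM² = 4a₀`;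
`γ₀ ≤ 4a₀` because `Cst 3 a₀ ≥ a₀⁻¹`).  NOT print's mode-by-mode (1.90) constant: a necessity constant. [cite: Balaban1984PropagatorsI, Prop. 1.1 (1.90) p.33; Balaban1985BackgroundPropagators, (3.118)-(3.122) pp.419-420] -/
theorem longDefect_one {a₀ : ℝ} (ha₀ : 0 < a₀) :
    ∀ Y : BondL2K ℂ 3 (periodsT3 F K) c₀ W₂, DstarL2 F n K c₀ 1 Y = 0 →
      ∃ ℓ : WL2 ℂ (fun _ : PBond (F.P n) 0 => cB) W₂,
        (∀ μ' : SiteL2K ℂ 3 (periodsT3 F K) c₀ W₂, ⟪Qk F n K h c₀ cB 1 Y - ℓ, Qk F n K h c₀ cB 1 (DL2 F n K c₀ 1 μ')⟫_ℂ = 0) ∧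
        ‖ℓ‖ ^ 2 ≤ ((1 - 1 / (16 * a₀ * B5Prop11Plancherel.Cst 3 a₀)) / (a₀ * (c₀ / cB) * ((F.L : ℝ) ^ (K - n)) ^ 3)) *
          (RCLike.re ⟪Y, DeltaEta F n K c₀ 1 Y⟫_ℂ + (a₀ * (c₀ / cB) * ((F.L : ℝ) ^ (K - n)) ^ 3) * ‖Qk F n K h c₀ cB 1 Y‖ ^ 2) := by
  have hc₀ : 0 < c₀ := Fact.out
  have hcB : 0 < cB := Fact.out
  have hL : (0 : ℝ) < F.L := by have := F.hL.2; exact_mod_cast (by omega : 0 < F.L)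
  have hℓ3 : 0 < ((F.L : ℝ) ^ (K - n)) ^ 3 := by positivity
  set a : ℝ := a₀ * (c₀ / cB) * ((F.L : ℝ) ^ (K - n)) ^ 3 with ha
  have ha0 : 0 < a := by positivity
  set M2 : ℝ := 4 * (cB / c₀) * (((F.L : ℝ) ^ (K - n)) ^ 3)⁻¹ with hM2
  have hM0 : 0 < M2 := by positivity
  have haM : a * M2 = 4 * a₀ := by rw [ha, hM2]; field_simp
  have hC1 : 1 / a₀ ≤ B5Prop11Plancherel.Cst 3 a₀ := le_trans (le_max_left _ _) (le_max_right _ _)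
  have hCpos : 0 < B5Prop11Plancherel.Cst 3 a₀ := lt_of_lt_of_le (by positivity) hC1
  have haC : 1 ≤ a₀ * B5Prop11Plancherel.Cst 3 a₀ := by
    have := mul_le_mul_of_nonneg_left hC1 ha₀.le
    rwa [mul_one_div_cancel ha₀.ne'] at this
  set γ : ℝ := 1 / (4 * B5Prop11Plancherel.Cst 3 a₀) with hγ
  have hγ0 : 0 ≤ γ := by positivity
  have hγM : γ ≤ a * M2 := by
    rw [haM, hγ, div_le_iff₀ (by positivity)]
    nlinarith [haC, ha₀]
  have key := longDefect_of_gaugeFixedFloor_of_hessian_kills_gauges (h := h) (cB := cB) (n := n) 1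
    (Prop7LaplaceAFlatCoercive.DeltaEta_one_DL2_one (n := n)) hγ0 ha0 hM0 hγM (gaugeFixedFloor_one_piSlot ha₀) (norm_sq_Qk_one_le)
  have e : (1 - γ / (a * M2)) / a = (1 - 1 / (16 * a₀ * B5Prop11Plancherel.Cst 3 a₀)) / a := by
    rw [haM, hγ]
    congr 1
    field_simp
    ring
  rw [e] at key
  exact key

/-! ## §5 The flat five-row door with all five rows kernel -/

/-- ★★ **THE FIVE-ROW DOOR IS INHABITED AT THE FLAT MEMBER, ALL FIVE ROWS KERNEL**: plugging (T)(1) ✓`transverseFloor_one`, (G)(1) ✓`sliceGaugeFloor_one` and (LD)(1) §4 into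
✓`gaugeFixedFloor_one_of_T_G_LD` at `t := 1 − δ∕2`, `δ := 1∕(16·a₀·Cst 3 a₀) ∈ (0, 1∕16]`, returns the flat γ-row on `{R_S(1) D*₁ A = 0}` with the member-uniform floor
`min((1 − (1 − δ)∕(1 − δ∕2))·γ₀, (δ∕2)·γ₀)`, `γ₀ = 1∕(4·Cst 3 a₀)` — weaker than ✓`gaugeFixedFloor_one_piSlot`'s `γ₀` (a Schur door loses constants), but positive and
volume-∕`k`-free: the (XM)∕(LD)∕(GQ) split is a faithful template at flat. [cite: Balaban1984PropagatorsI, Prop. 1.1 (1.90) p.33; Balaban1985BackgroundPropagators, Thm 3.11 p.416, (3.118)-(3.122) pp.419-420] -/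
theorem gaugeFixedFloor_one_of_fiveRows {a₀ : ℝ} (ha₀ : 0 < a₀) :
    ∀ A : BondL2K ℂ 3 (periodsT3 F K) c₀ W₂, RS F n K h c₀ cB 1 (DstarL2 F n K c₀ 1 A) = 0 →
      min ((1 - (1 - 1 / (16 * a₀ * B5Prop11Plancherel.Cst 3 a₀)) / (1 - 1 / (16 * a₀ * B5Prop11Plancherel.Cst 3 a₀) / 2))
              * (1 / (4 * B5Prop11Plancherel.Cst 3 a₀)))
          ((1 - (1 - 1 / (16 * a₀ * B5Prop11Plancherel.Cst 3 a₀) / 2)) * (1 / (4 * B5Prop11Plancherel.Cst 3 a₀))) * ‖A‖ ^ 2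
        ≤ RCLike.re ⟪A, DeltaEta F n K c₀ 1 A⟫_ℂ + (a₀ * (c₀ / cB) * ((F.L : ℝ) ^ (K - n)) ^ 3) * ‖Qk F n K h c₀ cB 1 A‖ ^ 2 := by
  have hc₀ : 0 < c₀ := Fact.out
  have hcB : 0 < cB := Fact.out
  have hL : (0 : ℝ) < F.L := by have := F.hL.2; exact_mod_cast (by omega : 0 < F.L)
  have hC1 : 1 / a₀ ≤ B5Prop11Plancherel.Cst 3 a₀ := le_trans (le_max_left _ _) (le_max_right _ _)
  have hCpos : 0 < B5Prop11Plancherel.Cst 3 a₀ := lt_of_lt_of_le (by positivity) hC1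
  have haC : 1 ≤ a₀ * B5Prop11Plancherel.Cst 3 a₀ := by
    have := mul_le_mul_of_nonneg_left hC1 ha₀.le
    rwa [mul_one_div_cancel ha₀.ne'] at this
  set δ : ℝ := 1 / (16 * a₀ * B5Prop11Plancherel.Cst 3 a₀) with hδ
  have hδ0 : 0 < δ := by positivity
  have hδ1 : δ ≤ 1 / 16 := by
    rw [hδ, div_le_div_iff₀ (by positivity) (by norm_num)]
    nlinarith [haC]
  set a : ℝ := a₀ * (c₀ / cB) * ((F.L : ℝ) ^ (K - n)) ^ 3 with ha
  have ha0 : 0 < a := by positivity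
  -- the window letters of the door: `κ := (1 − δ)/a`, `t := 1 − δ/2`
  have ht : 0 < 1 - δ / 2 := by linarith
  have ht1 : 1 - δ / 2 ≤ 1 := by linarith
  have hw : a * ((1 - δ) / a) / (1 - δ / 2) ≤ 1 := by
    rw [mul_div_cancel₀ _ ha0.ne', div_le_one ht]; linarith
  have key := gaugeFixedFloor_one_of_T_G_LD (h := h) (cB := cB) (n := n) (a := a) ha0.le (κ := (1 - δ) / a) ht ht1 hw
    (transverseFloor_one ha₀) (sliceGaugeFloor_one ha₀) (longDefect_one ha₀)
  intro A hA
  have h1 := key A hA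
  have e : a * ((1 - δ) / a) / (1 - δ / 2) = (1 - δ) / (1 - δ / 2) := by rw [mul_div_cancel₀ _ ha0.ne']
  rw [e] at h1
  exact h1

end Summit.QuantumFields.YangMills.Theorems.Prop7LongDefectOfGaugeFixedFloor

end
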